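import Summits.Ventures.CertifiedManyBodySolver.Downfold.BoxesLa214V115M2b
import Summits.Ventures.CertifiedManyBodySolver.Observables.StiffnessApexTransportCurtainLaBoxE
import HarnessLib

/-!
# M2(b) closers from the CURTAIN editions of the apex box instrument (`boxLa214E_M2b`, «La214-E» `[−3/10, −1/5] × [29/5, 74/5] × n = 1`)

Venture CertifiedManyBodySolver, cell `pub/hubbard-downfold` (MO-S1 ↔ S2 seam, D-0150 line L-DF2 «box ↦ one word»); namespace
`Summit.Ventures.CertifiedManyBodySolver.Downfold`; seat hubbard-downfold-unc-2 (`prover-hubbard-downfold-unc-2-g15-0`). Companion of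
`Downfold/BoxesLa214V115M2b.lean` (the M2(b) domain `boxLa214E_M2b` and its join `boxLa214E_M2b_stiffnessWord_of_laBoxE_leaf`) and of
`Observables/StiffnessApexTransportCurtain{,LaBoxE}.lean` (the curtain editions: the overhang of the one-station box is asked only for the CORNER
objective `−X₀(−3/10)`; the «L» bottom + left edge has no overhang; the hybrid with a short overhang at `U_L = 11`).

ONE-`exact` CLOSERS of the M2(b) stiffness word `HoldsOn (p ↦ ObsStiffnessSeqCeilingAt (p tp) (p U) (p n) c) boxLa214E_M2b`:
* `boxLa214E_M2b_stiffnessWord_of_apexStation29o5_inner_and_cornerObjectiveOverhang` — (E1) family form: inner own-word family on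
  `[−3/10, −1/5] × {29/5}` + overhang family on `[−357/740, −3/10] × {29/5}` for the FIXED objective `−X₀(−3/10)`;
* `boxLa214E_M2b_stiffnessWord_of_apexStation29o5_innerChord_and_cornerObjectiveOverhangChord` — (E1) THE TWO BOXDUAL BUNDLES of the plan of
  record (obs RULING (fff) d302 (fff2) / (iii) d305 (iii2)) with ONE change: the outer bundle's objective is the CONSTANT `−X₀(−3/10)`; `c ≥` the
  four vertex constants;
* `boxLa214E_M2b_stiffnessWord_of_bottomEdge_and_leftEdge` / `…_of_bottomChord_and_leftEdgeChord` — (E2) the «L»: bottom bundle + left edge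
  `{−3/10} × [29/5, 74/5]` (family / two chords, the left chord IN `U`);
* `boxLa214E_M2b_stiffnessWord_of_curtain11` — (E3): bottom bundle + left edge `[29/5, 11]` + overhang `[−279/740, −3/10] × {11}` with objective
  `−X₀(−3/10)`.

Everything here is PROVED; no `sorry`, no definition. HONEST FRAMING: one-sided stiffness CEILINGS conditional BY NAME on the bundles plugged in
(CONTROL/CALIBRATION class at Mott points; a ceiling is silent on `ρ_s = 0`); typing certifies nothing about La₂CuO₄; no phase sentence; no number
of record (the kinematic scales 0.4392 / 0.5037 quoted in the companions are [float] planning arithmetic).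
-/

noncomputable section

namespace Summit.Ventures.CertifiedManyBodySolver.Downfold

open Set NonemptyInterval
open Summit.Ventures.CertifiedManyBodySolver.Observables
open Summit.Ventures.CertifiedManyBodySolver.Certificates
open Literature.MathematicalPhysics.QuantumLattice Literature.MathematicalPhysics.QuantumLattice.ThermodynamicLimit
open Literature.Probability.LatticeModels
open Matrix Finset HubbardWave0
open scoped BigOperators ComplexOrder

/-! ## §1 (E1) ONE STATION `29/5`, the overhang asked for the CORNER objective `−X₀(−3/10)` -/

/-- **M2(b) CLOSER — (E1), family form.** An own-word orbit-lower family `valI` on the inner source segment `[−3/10, −1/5] × {29/5}` and an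
orbit-lower family `valO` for the FIXED corner objective `−X₀(−3/10)` on the overhang `[−357/740, −3/10] × {29/5}` (half filling), both with
`−val ≤ c`, give the stiffness word `c` on `boxLa214E_M2b`. [cite: KomaTasaki1994, §1] [cite: ScalapinoWhiteZhang1993, §II] -/
theorem boxLa214E_M2b_stiffnessWord_of_apexStation29o5_inner_and_cornerObjectiveOverhang (valI valO : ℝ → ℝ) (c : ℚ)
    (hI : ∀ s ∈ Set.Icc (-3 / 10 : ℝ) (-1 / 5),
      ∀ (ω : InfVolFermionState 2) (Ls : ℕ → ℕ) (ψ : ∀ L, Fock (Orb (FermionTorus 2 L))),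
      Filter.Tendsto Ls Filter.atTop Filter.atTop →
      (∀ j, IsGroundStateInSector (hubbardTorusTT' (Ls j) 1 s (29 / 5)) (rectN 1 (Ls j)) 0 (ψ (Ls j))) →
      (∀ j, star (ψ (Ls j)) ⬝ᵥ ψ (Ls j) = 1) → ω.IsTorusLimitOf ψ Ls →
      valI s ≤ ((Finset.univ : Finset (DihedralGroup 4)).card : ℝ)⁻¹ * ∑ g ∈ (Finset.univ : Finset (DihedralGroup 4)),
        (ω.expect (d4ShiftSet g 0 (Literature.Probability.LatticeModels.box 2 7))
          (fermionEmbed (PolySite.d4Emb g 0 (Literature.Probability.LatticeModels.box 2 7)) (-oddMomentObsTT s (29 / 5) 0))).re)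
    (hcI : ∀ s ∈ Set.Icc (-3 / 10 : ℝ) (-1 / 5), -valI s ≤ ((c : ℚ) : ℝ))
    (hO : ∀ s ∈ Set.Icc (-(357 / 740) : ℝ) (-3 / 10),
      ∀ (ω : InfVolFermionState 2) (Ls : ℕ → ℕ) (ψ : ∀ L, Fock (Orb (FermionTorus 2 L))),
      Filter.Tendsto Ls Filter.atTop Filter.atTop →
      (∀ j, IsGroundStateInSector (hubbardTorusTT' (Ls j) 1 s (29 / 5)) (rectN 1 (Ls j)) 0 (ψ (Ls j))) →
      (∀ j, star (ψ (Ls j)) ⬝ᵥ ψ (Ls j) = 1) → ω.IsTorusLimitOf ψ Ls →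
      valO s ≤ ((Finset.univ : Finset (DihedralGroup 4)).card : ℝ)⁻¹ * ∑ g ∈ (Finset.univ : Finset (DihedralGroup 4)),
        (ω.expect (d4ShiftSet g 0 (Literature.Probability.LatticeModels.box 2 7))
          (fermionEmbed (PolySite.d4Emb g 0 (Literature.Probability.LatticeModels.box 2 7)) (-oddMomentObsTT (-3 / 10) (29 / 5) 0))).re)
    (hcO : ∀ s ∈ Set.Icc (-(357 / 740) : ℝ) (-3 / 10), -valO s ≤ ((c : ℚ) : ℝ)) :
    HoldsOn (fun p : OneBandCoord → ℝ => ObsStiffnessSeqCeilingAt (p .tpOverT) (p .UOverT) (p .filling) c) boxLa214E_M2b :=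
  boxLa214E_M2b_stiffnessWord_of_laBoxE_leaf
    (ObsStiffnessSeqCeilingAt_on_laBoxE_of_apexStation29o5_inner_and_cornerObjectiveOverhang valI valO c hI hcI hO hcO)

/-- **M2(b) CLOSER — (E1), THE TWO BOXDUAL BUNDLES WITH THE OUTER OBJECTIVE SWAPPED.** The INNER bundle on `[−3/10, −1/5] × {29/5}`: the chord
of the own-word vertex constants `vI₁` (at `−3/10`) and `vI₂` (at `−1/5`); the OUTER bundle on `[−357/740, −3/10] × {29/5}`: the chord of the vertex
constants `vO₁` (at `−357/740`) and `vO₂` (at `−3/10`) for the CONSTANT objective `−X₀(−3/10)` (`-oddMomentObsTT (-3/10) (29/5) 0` at every `s`);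
`c ≥ −vI₁, −vI₂, −vO₁, −vO₂`. Then the stiffness word `c` holds on `boxLa214E_M2b`. (Versus `boxLa214E_M2b_stiffnessWord_of_apexStation29o5_two_chords`
of the companion: same four vertices, same station, only the outer objective's hopping slot changes `s ↦ −3/10`.)
[cite: KomaTasaki1994, §1] [cite: ScalapinoWhiteZhang1993, §II] -/
theorem boxLa214E_M2b_stiffnessWord_of_apexStation29o5_innerChord_and_cornerObjectiveOverhangChord (vI₁ vI₂ vO₁ vO₂ : ℝ) (c : ℚ)
    (hcI₁ : -vI₁ ≤ ((c : ℚ) : ℝ)) (hcI₂ : -vI₂ ≤ ((c : ℚ) : ℝ)) (hcO₁ : -vO₁ ≤ ((c : ℚ) : ℝ)) (hcO₂ : -vO₂ ≤ ((c : ℚ) : ℝ))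
    (hInner : ∀ s ∈ Set.Icc (-3 / 10 : ℝ) (-1 / 5),
      ∀ (ω : InfVolFermionState 2) (Ls : ℕ → ℕ) (ψ : ∀ L, Fock (Orb (FermionTorus 2 L))),
      Filter.Tendsto Ls Filter.atTop Filter.atTop →
      (∀ j, IsGroundStateInSector (hubbardTorusTT' (Ls j) 1 s (29 / 5)) (rectN 1 (Ls j)) 0 (ψ (Ls j))) →
      (∀ j, star (ψ (Ls j)) ⬝ᵥ ψ (Ls j) = 1) → ω.IsTorusLimitOf ψ Ls →
      (-1 / 5 - s) / (-1 / 5 - -3 / 10) * vI₁ + (s - -3 / 10) / (-1 / 5 - -3 / 10) * vI₂ ≤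
        ((Finset.univ : Finset (DihedralGroup 4)).card : ℝ)⁻¹ * ∑ g ∈ (Finset.univ : Finset (DihedralGroup 4)),
          (ω.expect (d4ShiftSet g 0 (Literature.Probability.LatticeModels.box 2 7))
            (fermionEmbed (PolySite.d4Emb g 0 (Literature.Probability.LatticeModels.box 2 7)) (-oddMomentObsTT s (29 / 5) 0))).re)
    (hOuter : ∀ s ∈ Set.Icc (-(357 / 740) : ℝ) (-3 / 10),
      ∀ (ω : InfVolFermionState 2) (Ls : ℕ → ℕ) (ψ : ∀ L, Fock (Orb (FermionTorus 2 L))),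
      Filter.Tendsto Ls Filter.atTop Filter.atTop →
      (∀ j, IsGroundStateInSector (hubbardTorusTT' (Ls j) 1 s (29 / 5)) (rectN 1 (Ls j)) 0 (ψ (Ls j))) →
      (∀ j, star (ψ (Ls j)) ⬝ᵥ ψ (Ls j) = 1) → ω.IsTorusLimitOf ψ Ls →
      (-3 / 10 - s) / (-3 / 10 - -(357 / 740)) * vO₁ + (s - -(357 / 740)) / (-3 / 10 - -(357 / 740)) * vO₂ ≤
        ((Finset.univ : Finset (DihedralGroup 4)).card : ℝ)⁻¹ * ∑ g ∈ (Finset.univ : Finset (DihedralGroup 4)),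
          (ω.expect (d4ShiftSet g 0 (Literature.Probability.LatticeModels.box 2 7))
            (fermionEmbed (PolySite.d4Emb g 0 (Literature.Probability.LatticeModels.box 2 7)) (-oddMomentObsTT (-3 / 10) (29 / 5) 0))).re) :
    HoldsOn (fun p : OneBandCoord → ℝ => ObsStiffnessSeqCeilingAt (p .tpOverT) (p .UOverT) (p .filling) c) boxLa214E_M2b := by
  refine boxLa214E_M2b_stiffnessWord_of_apexStation29o5_inner_and_cornerObjectiveOverhang
    (fun s => (-1 / 5 - s) / (-1 / 5 - -3 / 10) * vI₁ + (s - -3 / 10) / (-1 / 5 - -3 / 10) * vI₂)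
    (fun s => (-3 / 10 - s) / (-3 / 10 - -(357 / 740)) * vO₁ + (s - -(357 / 740)) / (-3 / 10 - -(357 / 740)) * vO₂) c hInner
    (fun s hs => ?_) hOuter (fun s hs => ?_)
  · obtain ⟨hl₁, hl₂, hsum, -, -⟩ := tPrimeSegment_weights (by norm_num : (-3 / 10 : ℝ) < -1 / 5) hs.1 hs.2
    have hmin := min_le_chord_of_weights (c₁ := vI₁) (c₂ := vI₂) hl₁ hl₂ hsum
    have hneg : -min vI₁ vI₂ ≤ ((c : ℚ) : ℝ) := by
      rcases le_total vI₁ vI₂ with hv | hv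
      · rw [min_eq_left hv]; exact hcI₁
      · rw [min_eq_right hv]; exact hcI₂
    linarith
  · obtain ⟨hl₁, hl₂, hsum, -, -⟩ := tPrimeSegment_weights (by norm_num : (-(357 / 740) : ℝ) < -3 / 10) hs.1 hs.2
    have hmin := min_le_chord_of_weights (c₁ := vO₁) (c₂ := vO₂) hl₁ hl₂ hsum
    have hneg : -min vO₁ vO₂ ≤ ((c : ℚ) : ℝ) := by
      rcases le_total vO₁ vO₂ with hv | hv
      · rw [min_eq_left hv]; exact hcO₁
      · rw [min_eq_right hv]; exact hcO₂
    linarith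

/-! ## §2 (E2) THE «L»: bottom bundle + the LEFT EDGE `{−3/10} × [29/5, 74/5]`, no overhang -/

/-- **M2(b) CLOSER — (E2), family form.** An own-word orbit-lower family `valB` on the bottom inner segment `[−3/10, −1/5] × {29/5}` and an
own-word orbit-lower family `valL` on the left edge `{−3/10} × [29/5, 74/5]` (half filling), both with `−val ≤ c`, give the stiffness word `c` on
`boxLa214E_M2b`; no source lies outside the box. [cite: KomaTasaki1994, §1] [cite: ScalapinoWhiteZhang1993, §II] -/
theorem boxLa214E_M2b_stiffnessWord_of_bottomEdge_and_leftEdge (valB valL : ℝ → ℝ) (c : ℚ)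
    (hB : ∀ s ∈ Set.Icc (-3 / 10 : ℝ) (-1 / 5),
      ∀ (ω : InfVolFermionState 2) (Ls : ℕ → ℕ) (ψ : ∀ L, Fock (Orb (FermionTorus 2 L))),
      Filter.Tendsto Ls Filter.atTop Filter.atTop →
      (∀ j, IsGroundStateInSector (hubbardTorusTT' (Ls j) 1 s (29 / 5)) (rectN 1 (Ls j)) 0 (ψ (Ls j))) →
      (∀ j, star (ψ (Ls j)) ⬝ᵥ ψ (Ls j) = 1) → ω.IsTorusLimitOf ψ Ls →
      valB s ≤ ((Finset.univ : Finset (DihedralGroup 4)).card : ℝ)⁻¹ * ∑ g ∈ (Finset.univ : Finset (DihedralGroup 4)),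
        (ω.expect (d4ShiftSet g 0 (Literature.Probability.LatticeModels.box 2 7))
          (fermionEmbed (PolySite.d4Emb g 0 (Literature.Probability.LatticeModels.box 2 7)) (-oddMomentObsTT s (29 / 5) 0))).re)
    (hcB : ∀ s ∈ Set.Icc (-3 / 10 : ℝ) (-1 / 5), -valB s ≤ ((c : ℚ) : ℝ))
    (hL : ∀ U' ∈ Set.Icc (29 / 5 : ℝ) (74 / 5),
      ∀ (ω : InfVolFermionState 2) (Ls : ℕ → ℕ) (ψ : ∀ L, Fock (Orb (FermionTorus 2 L))),
      Filter.Tendsto Ls Filter.atTop Filter.atTop →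
      (∀ j, IsGroundStateInSector (hubbardTorusTT' (Ls j) 1 (-3 / 10) U') (rectN 1 (Ls j)) 0 (ψ (Ls j))) →
      (∀ j, star (ψ (Ls j)) ⬝ᵥ ψ (Ls j) = 1) → ω.IsTorusLimitOf ψ Ls →
      valL U' ≤ ((Finset.univ : Finset (DihedralGroup 4)).card : ℝ)⁻¹ * ∑ g ∈ (Finset.univ : Finset (DihedralGroup 4)),
        (ω.expect (d4ShiftSet g 0 (Literature.Probability.LatticeModels.box 2 7))
          (fermionEmbed (PolySite.d4Emb g 0 (Literature.Probability.LatticeModels.box 2 7)) (-oddMomentObsTT (-3 / 10) U' 0))).re)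
    (hcL : ∀ U' ∈ Set.Icc (29 / 5 : ℝ) (74 / 5), -valL U' ≤ ((c : ℚ) : ℝ)) :
    HoldsOn (fun p : OneBandCoord → ℝ => ObsStiffnessSeqCeilingAt (p .tpOverT) (p .UOverT) (p .filling) c) boxLa214E_M2b :=
  boxLa214E_M2b_stiffnessWord_of_laBoxE_leaf (ObsStiffnessSeqCeilingAt_on_laBoxE_of_bottomEdge_and_leftEdge valB valL c hB hcB hL hcL)

/-- **M2(b) CLOSER — (E2), two bundles, three vertices.** BOTTOM bundle on `[−3/10, −1/5] × {29/5}`: chord of the own-word vertex constants `vB₁`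
(at `(−3/10, 29/5)`) and `vB₂` (at `(−1/5, 29/5)`); LEFT-EDGE bundle on `{−3/10} × [29/5, 74/5]`: chord IN `U` of the own-word vertex constants `vL₁`
(at `(−3/10, 29/5)`) and `vL₂` (at `(−3/10, 74/5)`); `c ≥ −vB₁, −vB₂, −vL₁, −vL₂`. Then the stiffness word `c` holds on `boxLa214E_M2b`.
[cite: KomaTasaki1994, §1] [cite: ScalapinoWhiteZhang1993, §II] -/
theorem boxLa214E_M2b_stiffnessWord_of_bottomChord_and_leftEdgeChord (vB₁ vB₂ vL₁ vL₂ : ℝ) (c : ℚ)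
    (hcB₁ : -vB₁ ≤ ((c : ℚ) : ℝ)) (hcB₂ : -vB₂ ≤ ((c : ℚ) : ℝ)) (hcL₁ : -vL₁ ≤ ((c : ℚ) : ℝ)) (hcL₂ : -vL₂ ≤ ((c : ℚ) : ℝ))
    (hB : ∀ s ∈ Set.Icc (-3 / 10 : ℝ) (-1 / 5),
      ∀ (ω : InfVolFermionState 2) (Ls : ℕ → ℕ) (ψ : ∀ L, Fock (Orb (FermionTorus 2 L))),
      Filter.Tendsto Ls Filter.atTop Filter.atTop →
      (∀ j, IsGroundStateInSector (hubbardTorusTT' (Ls j) 1 s (29 / 5)) (rectN 1 (Ls j)) 0 (ψ (Ls j))) →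
      (∀ j, star (ψ (Ls j)) ⬝ᵥ ψ (Ls j) = 1) → ω.IsTorusLimitOf ψ Ls →
      (-1 / 5 - s) / (-1 / 5 - -3 / 10) * vB₁ + (s - -3 / 10) / (-1 / 5 - -3 / 10) * vB₂ ≤
        ((Finset.univ : Finset (DihedralGroup 4)).card : ℝ)⁻¹ * ∑ g ∈ (Finset.univ : Finset (DihedralGroup 4)),
          (ω.expect (d4ShiftSet g 0 (Literature.Probability.LatticeModels.box 2 7))
            (fermionEmbed (PolySite.d4Emb g 0 (Literature.Probability.LatticeModels.box 2 7)) (-oddMomentObsTT s (29 / 5) 0))).re)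
    (hL : ∀ U' ∈ Set.Icc (29 / 5 : ℝ) (74 / 5),
      ∀ (ω : InfVolFermionState 2) (Ls : ℕ → ℕ) (ψ : ∀ L, Fock (Orb (FermionTorus 2 L))),
      Filter.Tendsto Ls Filter.atTop Filter.atTop →
      (∀ j, IsGroundStateInSector (hubbardTorusTT' (Ls j) 1 (-3 / 10) U') (rectN 1 (Ls j)) 0 (ψ (Ls j))) →
      (∀ j, star (ψ (Ls j)) ⬝ᵥ ψ (Ls j) = 1) → ω.IsTorusLimitOf ψ Ls →
      (74 / 5 - U') / (74 / 5 - 29 / 5) * vL₁ + (U' - 29 / 5) / (74 / 5 - 29 / 5) * vL₂ ≤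
        ((Finset.univ : Finset (DihedralGroup 4)).card : ℝ)⁻¹ * ∑ g ∈ (Finset.univ : Finset (DihedralGroup 4)),
          (ω.expect (d4ShiftSet g 0 (Literature.Probability.LatticeModels.box 2 7))
            (fermionEmbed (PolySite.d4Emb g 0 (Literature.Probability.LatticeModels.box 2 7)) (-oddMomentObsTT (-3 / 10) U' 0))).re) :
    HoldsOn (fun p : OneBandCoord → ℝ => ObsStiffnessSeqCeilingAt (p .tpOverT) (p .UOverT) (p .filling) c) boxLa214E_M2b :=
  boxLa214E_M2b_stiffnessWord_of_laBoxE_leaf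
    (ObsStiffnessSeqCeilingAt_halfFilling_on_box_of_bottomChord_and_leftEdgeChord (by norm_num) (by norm_num) (by norm_num) (by norm_num)
      vB₁ vB₂ vL₁ vL₂ c hcB₁ hcB₂ hcL₁ hcL₂ hB hL)

/-! ## §3 (E3) with `U_L = 11`: bottom bundle + left edge `[29/5, 11]` + a short corner-objective overhang at station `11` -/

/-- **M2(b) CLOSER — (E3), `U_L = 11`.** Own-word families on the bottom inner segment `[−3/10, −1/5] × {29/5}` (`valB`) and on the left edge
`{−3/10} × [29/5, 11]` (`valL`), and a family for the FIXED corner objective `−X₀(−3/10)` on the overhang `[−279/740, −3/10] × {11}` (`valO`), all with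
`−val ≤ c` (half filling), give the stiffness word `c` on `boxLa214E_M2b`. [cite: KomaTasaki1994, §1] [cite: ScalapinoWhiteZhang1993, §II] -/
theorem boxLa214E_M2b_stiffnessWord_of_curtain11 (valB valL valO : ℝ → ℝ) (c : ℚ)
    (hB : ∀ s ∈ Set.Icc (-3 / 10 : ℝ) (-1 / 5),
      ∀ (ω : InfVolFermionState 2) (Ls : ℕ → ℕ) (ψ : ∀ L, Fock (Orb (FermionTorus 2 L))),
      Filter.Tendsto Ls Filter.atTop Filter.atTop →
      (∀ j, IsGroundStateInSector (hubbardTorusTT' (Ls j) 1 s (29 / 5)) (rectN 1 (Ls j)) 0 (ψ (Ls j))) →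
      (∀ j, star (ψ (Ls j)) ⬝ᵥ ψ (Ls j) = 1) → ω.IsTorusLimitOf ψ Ls →
      valB s ≤ ((Finset.univ : Finset (DihedralGroup 4)).card : ℝ)⁻¹ * ∑ g ∈ (Finset.univ : Finset (DihedralGroup 4)),
        (ω.expect (d4ShiftSet g 0 (Literature.Probability.LatticeModels.box 2 7))
          (fermionEmbed (PolySite.d4Emb g 0 (Literature.Probability.LatticeModels.box 2 7)) (-oddMomentObsTT s (29 / 5) 0))).re)
    (hcB : ∀ s ∈ Set.Icc (-3 / 10 : ℝ) (-1 / 5), -valB s ≤ ((c : ℚ) : ℝ))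
    (hL : ∀ U' ∈ Set.Icc (29 / 5 : ℝ) 11,
      ∀ (ω : InfVolFermionState 2) (Ls : ℕ → ℕ) (ψ : ∀ L, Fock (Orb (FermionTorus 2 L))),
      Filter.Tendsto Ls Filter.atTop Filter.atTop →
      (∀ j, IsGroundStateInSector (hubbardTorusTT' (Ls j) 1 (-3 / 10) U') (rectN 1 (Ls j)) 0 (ψ (Ls j))) →
      (∀ j, star (ψ (Ls j)) ⬝ᵥ ψ (Ls j) = 1) → ω.IsTorusLimitOf ψ Ls →
      valL U' ≤ ((Finset.univ : Finset (DihedralGroup 4)).card : ℝ)⁻¹ * ∑ g ∈ (Finset.univ : Finset (DihedralGroup 4)),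
        (ω.expect (d4ShiftSet g 0 (Literature.Probability.LatticeModels.box 2 7))
          (fermionEmbed (PolySite.d4Emb g 0 (Literature.Probability.LatticeModels.box 2 7)) (-oddMomentObsTT (-3 / 10) U' 0))).re)
    (hcL : ∀ U' ∈ Set.Icc (29 / 5 : ℝ) 11, -valL U' ≤ ((c : ℚ) : ℝ))
    (hO : ∀ s ∈ Set.Icc (-(279 / 740) : ℝ) (-3 / 10),
      ∀ (ω : InfVolFermionState 2) (Ls : ℕ → ℕ) (ψ : ∀ L, Fock (Orb (FermionTorus 2 L))),
      Filter.Tendsto Ls Filter.atTop Filter.atTop →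
      (∀ j, IsGroundStateInSector (hubbardTorusTT' (Ls j) 1 s 11) (rectN 1 (Ls j)) 0 (ψ (Ls j))) →
      (∀ j, star (ψ (Ls j)) ⬝ᵥ ψ (Ls j) = 1) → ω.IsTorusLimitOf ψ Ls →
      valO s ≤ ((Finset.univ : Finset (DihedralGroup 4)).card : ℝ)⁻¹ * ∑ g ∈ (Finset.univ : Finset (DihedralGroup 4)),
        (ω.expect (d4ShiftSet g 0 (Literature.Probability.LatticeModels.box 2 7))
          (fermionEmbed (PolySite.d4Emb g 0 (Literature.Probability.LatticeModels.box 2 7)) (-oddMomentObsTT (-3 / 10) 11 0))).re)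
    (hcO : ∀ s ∈ Set.Icc (-(279 / 740) : ℝ) (-3 / 10), -valO s ≤ ((c : ℚ) : ℝ)) :
    HoldsOn (fun p : OneBandCoord → ℝ => ObsStiffnessSeqCeilingAt (p .tpOverT) (p .UOverT) (p .filling) c) boxLa214E_M2b :=
  boxLa214E_M2b_stiffnessWord_of_laBoxE_leaf (ObsStiffnessSeqCeilingAt_on_laBoxE_of_curtain11 valB valL valO c hB hcB hL hcL hO hcO)

end Summit.Ventures.CertifiedManyBodySolver.Downfold

end
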